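import Summits.CriticalPhenomena.SAWScalingLimit.Theorems.SAWTensorRGRestrictionOfLimitRadoFinite
import Summits.CriticalPhenomena.SAWScalingLimit.Theorems.SAWTensorRGRestrictionOfLimitRadoModelPath
import HarnessLib

/-!
# Radó squeezes, part 10: the boundary loop of the squeezed domain

Support file (`--supports stmt-CriticalPhenomena-0773`, towards the registered stub `stub_radoSqueezeFamily`,
geometry F′ of the line `birth` for the crux `RestrictionOfLimit`). Pure plane topology.

Given defect data `d n` for the good members of a real sequence `xs` (parts 8–9), a level `η ∈ (0, 1/4]` and a
finite set `S` of TREATED indices, the loop `loopΓ η S : ℝ → ℂ` is defined on the window `[m₀, m₀ + 1]` of the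
parameter of `∂D'` by: `D'.boundary y` at non-free parameters; and at a free parameter `y` of the window, with
first-hit index `n` of its component `(θ₁, θ₂)` and relative position `u = (y - θ₁)/(θ₂ - θ₁)`, the chart image
`(d n).G (pPar η u)` of the collar path if `n ∈ S` and `(d n).G (qPar u)` (the arc `β` of `∂D`) otherwise. We
prove: the value formula is independent of the point used to compute the first hit (`loopΓ_eq`), continuity on
`ℝ` (at accumulation points of free arcs by the finiteness of large defect sides, part 9), injectivity on the
window, the values at the end-points of the window, and the position of the values (in `closure U_n`, and off
`closure D'` at free parameters).

Axioms `propext`, `Classical.choice`, `Quot.sound`.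
-/

noncomputable section

open Set Filter Topology Metric Complex
open Literature.Topology.PlaneTopology Literature.Probability.RandomPlanarGeometry
open scoped Classical

namespace Summit.CriticalPhenomena.SAWScalingLimit.Theorems.RestrictionOfLimit.Birth

section Loop

variable {D D' : DobrushinDomain} {F : Set ℝ} (xs : ℕ → ℝ)
  (d : ∀ n : ℕ, xs n ∈ F ∧ xs n ∈ Ioo (D'.mark 0) (D'.mark 0 + 1) → DefectData D D' F (xs n))
  (hex : ∀ y : ℝ, y ∈ F ∧ y ∈ Ioo (D'.mark 0) (D'.mark 0 + 1) →
    ∃ n : ℕ, (xs n ∈ F ∧ xs n ∈ Ioo (D'.mark 0) (D'.mark 0 + 1)) ∧ xs n ∈ connectedComponentIn F y)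

/-- The **model path of index `n`** at level `η` with treated set `S`: the collar path if `n` is treated, the
semicircle path otherwise. [folklore] -/
def modelPath (η : ℝ) (S : Finset ℕ) (n : ℕ) (u : ℝ) : ℂ := if n ∈ S then pPar η u else qPar u

/-- The **relative position** of `y` in the component `(θ₁, θ₂)` of `F` containing it. [folklore] -/
def relPos (F : Set ℝ) (y : ℝ) : ℝ :=
  (y - sInf (connectedComponentIn F y)) / (sSup (connectedComponentIn F y) - sInf (connectedComponentIn F y))

/-- **The boundary loop of the squeezed domain on the window** (see the module docstring). [folklore] -/
def loopΓ (η : ℝ) (S : Finset ℕ) (y : ℝ) : ℂ :=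
  if h : y ∈ F ∧ y ∈ Ioo (D'.mark 0) (D'.mark 0 + 1) then
    (d (Nat.find (hex y h)) (Nat.find_spec (hex y h)).1).G (modelPath η S (Nat.find (hex y h)) (relPos F y))
  else D'.boundary y

/-! ### Elementary facts on the model path -/

/-- The model path is continuous. [folklore] -/
theorem continuous_modelPath (η : ℝ) (S : Finset ℕ) (n : ℕ) : Continuous (modelPath η S n) := by
  unfold modelPath; split_ifs
  · exact continuous_pPar η
  · exact continuous_qPar

/-- End-points of the model path. [folklore] -/
theorem modelPath_zero_one {η : ℝ} (hη0 : 0 < η) (hη : η ≤ 1 / 4) (S : Finset ℕ) (n : ℕ) :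
    modelPath η S n 0 = 1 ∧ modelPath η S n 1 = -1 := by
  unfold modelPath; split_ifs
  · exact pPar_zero_one hη0.le hη
  · exact qPar_zero_one

/-- **Values of the model path at interior parameters**: in the closed half-disc, with positive height, and
either strictly inside the disc (then treated, on the chord) or on the unit circle. [folklore] -/
theorem modelPath_mem {η : ℝ} (hη0 : 0 < η) (hη : η ≤ 1 / 4) (S : Finset ℕ) (n : ℕ) {u : ℝ}
    (hu : u ∈ Ioo (0 : ℝ) 1) :
    ‖modelPath η S n u‖ ≤ 1 ∧ 0 < (modelPath η S n u).im ∧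
      (‖modelPath η S n u‖ < 1 → n ∈ S ∧ (modelPath η S n u).im = η) := by
  have hu' : u ∈ Icc (0 : ℝ) 1 := ⟨hu.1.le, hu.2.le⟩
  unfold modelPath; split_ifs with hn
  · rcases pPar_dichotomy hη0 hη hu with ⟨h1, h2⟩ | ⟨h1, h2, -⟩
    · exact ⟨h1.le, by rw [h2]; exact hη0, fun _ ↦ ⟨hn, h2⟩⟩
    · exact ⟨h1.le, h2, fun h ↦ absurd h1 h.ne⟩
  · exact ⟨(norm_qPar hu').1.le, qPar_im_pos hu, fun h ↦ absurd (norm_qPar hu').1 h.ne⟩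

/-- The model path is injective on `[0, 1]`. [folklore] -/
theorem modelPath_injOn {η : ℝ} (hη0 : 0 < η) (hη : η ≤ 1 / 4) (S : Finset ℕ) (n : ℕ) :
    InjOn (modelPath η S n) (Icc 0 1) := by
  unfold modelPath; split_ifs
  · exact pPar_injOn hη0 hη
  · exact qPar_injective.injOn

/-! ### The first hit and the value formula -/

variable (hF : F = {θ : ℝ | D'.boundary θ ∈ D.carrier}) (hsub : D'.carrier ⊆ D.carrier)
  (h0 : D'.pt 0 = D.pt 0) (h1 : D'.pt 1 = D.pt 1)

/-- **The first hit of a component.** For a free `y` of the window there is an index `n` of a good member of its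
component, minimal among good members hitting it; its component is that of `y`, and it is a representative.
[folklore] -/
theorem firstHit_spec {y : ℝ} (h : y ∈ F ∧ y ∈ Ioo (D'.mark 0) (D'.mark 0 + 1)) :
    (xs (Nat.find (hex y h)) ∈ F ∧ xs (Nat.find (hex y h)) ∈ Ioo (D'.mark 0) (D'.mark 0 + 1)) ∧
      connectedComponentIn F (xs (Nat.find (hex y h))) = connectedComponentIn F y ∧
      (∀ k < Nat.find (hex y h), xs k ∈ F ∧ xs k ∈ Ioo (D'.mark 0) (D'.mark 0 + 1) →
        connectedComponentIn F (xs k) ≠ connectedComponentIn F (xs (Nat.find (hex y h)))) := by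
  obtain ⟨hgood, hmem⟩ := Nat.find_spec (hex y h)
  have hcc : connectedComponentIn F (xs (Nat.find (hex y h))) = connectedComponentIn F y :=
    (connectedComponentIn_eq hmem).symm
  refine ⟨hgood, hcc, fun k hk hk' heq ↦ Nat.find_min (hex y h) hk ⟨hk', ?_⟩⟩
  rw [← hcc, ← heq]
  exact mem_connectedComponentIn hk'.1

/-- **The value formula**, computed from any good member `xs n` of the component of `y` that is minimal among
good members hitting it. [folklore] -/
theorem loopΓ_eq (η : ℝ) (S : Finset ℕ) {y : ℝ} (h : y ∈ F ∧ y ∈ Ioo (D'.mark 0) (D'.mark 0 + 1)) {n : ℕ}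
    (hn : xs n ∈ F ∧ xs n ∈ Ioo (D'.mark 0) (D'.mark 0 + 1)) (hmem : xs n ∈ connectedComponentIn F y)
    (hmin : ∀ k < n, xs k ∈ F ∧ xs k ∈ Ioo (D'.mark 0) (D'.mark 0 + 1) → xs k ∉ connectedComponentIn F y) :
    loopΓ xs d hex η S y = (d n hn).G (modelPath η S n (relPos F y)) := by
  have hfind : Nat.find (hex y h) = n := by
    rw [Nat.find_eq_iff]
    exact ⟨⟨hn, hmem⟩, fun k hk ⟨hk', hkm⟩ ↦ hmin k hk hk' hkm⟩
  unfold loopΓ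
  rw [dif_pos h]
  subst hfind
  rfl

/-- The value of the loop off the free parameters of the window. [folklore] -/
theorem loopΓ_of_not (η : ℝ) (S : Finset ℕ) {y : ℝ} (h : ¬ (y ∈ F ∧ y ∈ Ioo (D'.mark 0) (D'.mark 0 + 1))) :
    loopΓ xs d hex η S y = D'.boundary y := by
  unfold loopΓ; rw [dif_neg h]

include hF h0 h1 in
/-- **Relative position of a free parameter**: in `(0, 1)`, and the closed free arc point of parameter `y` is
`D'.boundary (θ₁ + (θ₂ - θ₁) relPos)`. [folklore] -/
theorem relPos_mem {y : ℝ} (h : y ∈ F ∧ y ∈ Ioo (D'.mark 0) (D'.mark 0 + 1)) :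
    relPos F y ∈ Ioo (0 : ℝ) 1 ∧
      sInf (connectedComponentIn F y) + (sSup (connectedComponentIn F y) - sInf (connectedComponentIn F y)) *
        relPos F y = y := by
  obtain ⟨-, -, -, -, -, hix, hxs, -⟩ := free_component hF h0 h1 h.1 h.2
  have hℓ : 0 < sSup (connectedComponentIn F y) - sInf (connectedComponentIn F y) := by linarith
  refine ⟨⟨div_pos (by linarith) hℓ, (div_lt_one hℓ).2 (by linarith)⟩, ?_⟩
  unfold relPos
  field_simp
  ring

include hF hsub h0 h1 in
/-- **Position of the values at free parameters**: with `n` the first hit of the component of `y`, the value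
lies in `closure (d n).U`, off `closure D'`, off `{P, Q}`, and it lies in `D` exactly when `n` is treated and the
model point is on the open chord. [folklore] -/
theorem loopΓ_mem {η : ℝ} (hη0 : 0 < η) (hη : η ≤ 1 / 4) (S : Finset ℕ) {y : ℝ}
    (h : y ∈ F ∧ y ∈ Ioo (D'.mark 0) (D'.mark 0 + 1)) :
    loopΓ xs d hex η S y ∈ closure (d _ (firstHit_spec xs hex h).1).U ∧
      loopΓ xs d hex η S y ∉ closure D'.carrier ∧
      (loopΓ xs d hex η S y ∈ D.carrier →
        Nat.find (hex y h) ∈ S ∧ (modelPath η S (Nat.find (hex y h)) (relPos F y)).im = η ∧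
          ‖modelPath η S (Nat.find (hex y h)) (relPos F y)‖ < 1) ∧
      (loopΓ xs d hex η S y ∉ D.carrier →
        ∃ v ∈ Ioo (d _ (firstHit_spec xs hex h).1).s (d _ (firstHit_spec xs hex h).1).t,
          loopΓ xs d hex η S y = D.boundary v) := by
  obtain ⟨hgood, hcc, hmin⟩ := firstHit_spec xs hex h
  set n := Nat.find (hex y h) with hn_def
  set e := d n hgood with he
  have hxy : xs n ∈ connectedComponentIn F y := (Nat.find_spec (hex y h)).2
  have hval : loopΓ xs d hex η S y = e.G (modelPath η S n (relPos F y)) :=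
    loopΓ_eq xs d hex η S h hgood hxy fun k hk hk' hkm ↦ hmin k hk hk' ((connectedComponentIn_eq hkm).symm.trans
        hcc.symm)
  obtain ⟨hu, -⟩ := relPos_mem hF h0 h1 h
  obtain ⟨hle, hpos, hlt⟩ := modelPath_mem hη0 hη S n hu
  set p := modelPath η S n (relPos F y) with hp
  have hxw' : xs n ∈ F ∧ xs n ∈ Ioo (D'.mark 0) (D'.mark 0 + 1) := hgood
  rw [hval]
  refine ⟨e.G_mem_closure hle hpos.le, ?_, fun hD ↦ ?_, fun hnD ↦ ?_⟩
  · rcases hle.lt_or_eq with hlt1 | heq1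
    · intro hcl
      have : e.G p ∈ e.U ∩ closure D'.carrier := ⟨e.G_mem_U hlt1 hpos, hcl⟩
      rw [e.U_inter_closure] at this
      exact this
    · obtain ⟨v, hv, hvG⟩ := e.G_semicircle heq1 hpos
      rw [hvG]
      exact (e.beta_open_facts hF hsub h0 h1 hxw'.1 hxw'.2 hv).2.2.1
  · rcases hle.lt_or_eq with hlt1 | heq1
    · exact ⟨(hlt hlt1).1, (hlt hlt1).2, hlt1⟩
    · exfalso
      obtain ⟨v, hv, hvG⟩ := e.G_semicircle heq1 hpos
      rw [hvG] at hD
      exact (e.beta_open_facts hF hsub h0 h1 hxw'.1 hxw'.2 hv).2.2.2.1 hD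
  · rcases hle.lt_or_eq with hlt1 | heq1
    · exact absurd (e.U_subset (e.G_mem_U hlt1 hpos)) hnD
    · exact e.G_semicircle heq1 hpos

include hF h0 h1 in
/-- Non-free parameters of the half-open window are not free at all, and their boundary points are off `D` and in
`closure D'`. [folklore] -/
theorem not_free_of_not {y : ℝ} (hy : y ∈ Ico (D'.mark 0) (D'.mark 0 + 1))
    (h : ¬ (y ∈ F ∧ y ∈ Ioo (D'.mark 0) (D'.mark 0 + 1))) :
    y ∉ F ∧ D'.boundary y ∉ D.carrier ∧ D'.boundary y ∈ closure D'.carrier := by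
  have hyF : y ∉ F := fun hyF ↦ by
    have hne : y ≠ D'.mark 0 := fun heq ↦ by
      have := mark_add_int_notMem_free hF h0 h1 0 0
      simp only [Int.cast_zero, add_zero] at this
      exact this (heq ▸ hyF)
    exact h ⟨hyF, lt_of_le_of_ne hy.1 (Ne.symm hne), hy.2⟩
  exact ⟨hyF, (mem_free_iff hF y).not.1 hyF, frontier_subset_closure (D'.boundary_mem_frontier y)⟩

/-! ### Injectivity on the window -/

include hF hsub h0 h1 in
/-- **The loop is injective on the half-open window.** [folklore] -/
theorem loopΓ_injOn {η : ℝ} (hη0 : 0 < η) (hη : η ≤ 1 / 4) (S : Finset ℕ) :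
    InjOn (loopΓ xs d hex η S) (Ico (D'.mark 0) (D'.mark 0 + 1)) := by
  intro y₁ hy₁ y₂ hy₂ hyy
  by_cases h₁ : y₁ ∈ F ∧ y₁ ∈ Ioo (D'.mark 0) (D'.mark 0 + 1) <;>
    by_cases h₂ : y₂ ∈ F ∧ y₂ ∈ Ioo (D'.mark 0) (D'.mark 0 + 1)
  · -- both free
    obtain ⟨hg₁, hcc₁, hmin₁⟩ := firstHit_spec xs hex h₁
    obtain ⟨hg₂, hcc₂, hmin₂⟩ := firstHit_spec xs hex h₂
    obtain ⟨hcl₁, -, hD₁, hnD₁⟩ := loopΓ_mem xs d hex hF hsub h0 h1 hη0 hη S h₁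
    obtain ⟨hcl₂, -, -, -⟩ := loopΓ_mem xs d hex hF hsub h0 h1 hη0 hη S h₂
    set n₁ := Nat.find (hex y₁ h₁) with hn₁
    set n₂ := Nat.find (hex y₂ h₂) with hn₂
    by_cases hne : n₁ = n₂
    · -- same component, same chart
      have hcc : connectedComponentIn F y₁ = connectedComponentIn F y₂ := by rw [← hcc₁, ← hcc₂, hne]
      have hx₁ : xs n₁ ∈ connectedComponentIn F y₁ := (Nat.find_spec (hex y₁ h₁)).2
      have hv₁ := loopΓ_eq xs d hex η S h₁ hg₁ hx₁ fun k hk hk' hkm ↦ hmin₁ k hk hk'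
        ((connectedComponentIn_eq hkm).symm.trans hcc₁.symm)
      have hx₂ : xs n₁ ∈ connectedComponentIn F y₂ := by rw [← hcc]; exact hx₁
      have hv₂ := loopΓ_eq xs d hex η S h₂ hg₁ hx₂ fun k hk hk' hkm ↦ hmin₁ k hk hk'
        ((connectedComponentIn_eq hkm).symm.trans (hcc.symm.trans hcc₁.symm))
      rw [hv₁, hv₂] at hyy
      have hpath := (d n₁ hg₁).G.injective hyy
      obtain ⟨hu₁, hy₁eq⟩ := relPos_mem hF h0 h1 h₁
      obtain ⟨hu₂, hy₂eq⟩ := relPos_mem hF h0 h1 h₂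
      have := modelPath_injOn hη0 hη S n₁ ⟨hu₁.1.le, hu₁.2.le⟩ ⟨hu₂.1.le, hu₂.2.le⟩ hpath
      rw [← hy₁eq, ← hy₂eq, hcc, this]
    · -- different components: the common value would be an end-point
      exfalso
      have hccne : connectedComponentIn F (xs n₁) ≠ connectedComponentIn F (xs n₂) :=
        rep_disjoint_components xs ⟨hg₁, hmin₁⟩ ⟨hg₂, hmin₂⟩ hne
      have hmem := (d n₁ hg₁).closure_inter hF hsub h0 h1 hg₁.1 hg₁.2 hg₂.1 hg₂.2 hccne (d n₂ hg₂)
        ⟨hcl₁, hyy ▸ hcl₂⟩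
      obtain ⟨-, -, hPD, hQD, -⟩ := free_endpoints hF hsub h0 h1 hg₁.1 hg₁.2
      by_cases hD : loopΓ xs d hex η S y₁ ∈ D.carrier
      · rcases hmem with h | h
        · exact hPD (h ▸ hD)
        · exact hQD (h ▸ hD)
      · obtain ⟨v, hv, hvG⟩ := hnD₁ hD
        obtain ⟨hP, hQ, -⟩ := (d n₁ hg₁).beta_open_facts hF hsub h0 h1 hg₁.1 hg₁.2 hv
        rw [hvG] at hmem
        rcases hmem with h | h
        · exact hP h
        · exact hQ h
  · exfalso
    obtain ⟨-, hncl, -, -⟩ := loopΓ_mem xs d hex hF hsub h0 h1 hη0 hη S h₁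
    obtain ⟨-, -, hcl⟩ := not_free_of_not hF h0 h1 hy₂ h₂
    rw [hyy, loopΓ_of_not xs d hex η S h₂] at hncl
    exact hncl hcl
  · exfalso
    obtain ⟨-, hncl, -, -⟩ := loopΓ_mem xs d hex hF hsub h0 h1 hη0 hη S h₂
    obtain ⟨-, -, hcl⟩ := not_free_of_not hF h0 h1 hy₁ h₁
    rw [← hyy, loopΓ_of_not xs d hex η S h₁] at hncl
    exact hncl hcl
  · rw [loopΓ_of_not xs d hex η S h₁, loopΓ_of_not xs d hex η S h₂] at hyy
    exact D'.injOn_boundary_Ico (D'.mark 0) hy₁ hy₂ hyy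

/-! ### Continuity -/

include hF hsub h0 h1 in
/-- **The loop is continuous.** [folklore] -/
theorem continuous_loopΓ {η : ℝ} (hη0 : 0 < η) (hη : η ≤ 1 / 4) (S : Finset ℕ) :
    Continuous (loopΓ xs d hex η S) := by
  rw [continuous_iff_continuousAt]
  intro y₀
  -- the chart expression attached to a good index
  set g : ℕ → ℝ → ℂ := fun n y ↦ if hn : xs n ∈ F ∧ xs n ∈ Ioo (D'.mark 0) (D'.mark 0 + 1) then
      (d n hn).G (modelPath η S n ((y - sInf (connectedComponentIn F (xs n))) /
        (sSup (connectedComponentIn F (xs n)) - sInf (connectedComponentIn F (xs n)))))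
    else 0 with hg
  have hgc : ∀ n, Continuous (g n) := fun n ↦ by
    simp only [hg]
    split_ifs with hn
    · exact (d n hn).G.continuous.comp ((continuous_modelPath η S n).comp (by fun_prop))
    · exact continuous_const
  -- at free parameters whose first hit is `n`, the loop is `g n`
  have hΓg : ∀ y (h : y ∈ F ∧ y ∈ Ioo (D'.mark 0) (D'.mark 0 + 1)), loopΓ xs d hex η S y = g (Nat.find (hex y h))
      y := by
    intro y h
    obtain ⟨hgood, hcc, hmin⟩ := firstHit_spec xs hex h
    have hxy : xs (Nat.find (hex y h)) ∈ connectedComponentIn F y := (Nat.find_spec (hex y h)).2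
    rw [loopΓ_eq xs d hex η S h hgood hxy fun k hk hk' hkm ↦ hmin k hk hk' ((connectedComponentIn_eq
        hkm).symm.trans hcc.symm)]
    simp only [hg, dif_pos hgood, relPos, hcc]
  by_cases h₀ : y₀ ∈ F ∧ y₀ ∈ Ioo (D'.mark 0) (D'.mark 0 + 1)
  · -- free parameter: locally the loop is `g n₀`
    obtain ⟨hgood, hcc, hmin⟩ := firstHit_spec xs hex h₀
    set n₀ := Nat.find (hex y₀ h₀) with hn₀
    obtain ⟨hccy, -, -, hl, hr, -, -, -⟩ := free_component hF h0 h1 h₀.1 h₀.2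
    have hnhds : connectedComponentIn F y₀ ∈ 𝓝 y₀ :=
      (isOpen_free hF).connectedComponentIn.mem_nhds (mem_connectedComponentIn h₀.1)
    refine ((hgc n₀).continuousAt).congr (Filter.eventuallyEq_of_mem hnhds fun y hy ↦ ?_)
    have hyF : y ∈ F := connectedComponentIn_subset F y₀ hy
    have hyw : y ∈ Ioo (D'.mark 0) (D'.mark 0 + 1) := by
      have hy' : y ∈ Ioo (sInf (connectedComponentIn F y₀)) (sSup (connectedComponentIn F y₀)) := hccy ▸ hy
      obtain ⟨-, hi, -, -, -, -, -, -⟩ := free_component hF h0 h1 h₀.1 h₀.2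
      refine ⟨lt_of_le_of_lt hl hy'.1 , lt_of_lt_of_le hy'.2 hr⟩
    have h : y ∈ F ∧ y ∈ Ioo (D'.mark 0) (D'.mark 0 + 1) := ⟨hyF, hyw⟩
    have hccy' : connectedComponentIn F y = connectedComponentIn F y₀ := (connectedComponentIn_eq hy).symm
    have hfind : Nat.find (hex y h) = n₀ := by
      rw [Nat.find_eq_iff]
      refine ⟨⟨hgood, by rw [hccy', ← hcc]; exact mem_connectedComponentIn hgood.1⟩, fun k hk ⟨hk', hkm⟩ ↦ ?_⟩
      exact hmin k hk hk' ((connectedComponentIn_eq hkm).symm.trans (hccy'.trans hcc.symm))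
    rw [hΓg y h, hfind]
  · -- non-free parameter: `ε`-`δ` with the finiteness of large defect sides
    rw [Metric.continuousAt_iff']
    intro ε hε
    rw [loopΓ_of_not xs d hex η S h₀]
    obtain ⟨B, hBfin, hB⟩ := exists_finite_dist_lt hF hsub h0 h1 xs d (half_pos hε)
    have hw : ∀ᶠ y in 𝓝 y₀, dist (D'.boundary y) (D'.boundary y₀) < ε / 2 :=
      Metric.tendsto_nhds.1 (D'.continuous_boundary.tendsto y₀) _ (half_pos hε)
    -- the finitely many large components
    have hlarge : ∀ n ∈ B, ∀ᶠ y in 𝓝 y₀, ∀ h : y ∈ F ∧ y ∈ Ioo (D'.mark 0) (D'.mark 0 + 1),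
        Nat.find (hex y h) = n → dist (loopΓ xs d hex η S y) (D'.boundary y₀) < ε := by
      intro n _
      by_cases hn : xs n ∈ F ∧ xs n ∈ Ioo (D'.mark 0) (D'.mark 0 + 1)
      swap
      · exact Eventually.of_forall fun y h hfind ↦ absurd (firstHit_spec xs hex h).1 (hfind ▸ hn)
      obtain ⟨hccn, -, -, -, -, hix, hxs, -⟩ := free_component hF h0 h1 hn.1 hn.2
      set θ₁ := sInf (connectedComponentIn F (xs n)) with hθ₁
      set θ₂ := sSup (connectedComponentIn F (xs n)) with hθ₂
      -- membership of `y` in the component when its first hit is `n`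
      have hmemn : ∀ y (h : y ∈ F ∧ y ∈ Ioo (D'.mark 0) (D'.mark 0 + 1)), Nat.find (hex y h) = n →
          y ∈ Ioo θ₁ θ₂ := fun y h hfind ↦ by
        obtain ⟨-, hcc, -⟩ := firstHit_spec xs hex h
        rw [hfind] at hcc
        have : y ∈ connectedComponentIn F (xs n) := by rw [hcc]; exact mem_connectedComponentIn h.1
        rwa [hccn] at this
      by_cases hy₀ : y₀ ∈ Icc θ₁ θ₂
      · -- `y₀` is an end-point of the component
        have hy₀' : y₀ = θ₁ ∨ y₀ = θ₂ := by
          rcases hy₀.1.lt_or_eq with hlt | heq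
          · rcases hy₀.2.lt_or_eq with hlt' | heq'
            · exfalso
              have hmem : y₀ ∈ connectedComponentIn F (xs n) := by rw [hccn]; exact ⟨hlt, hlt'⟩
              obtain ⟨-, -, -, hl, hr, -, -, -⟩ := free_component hF h0 h1 hn.1 hn.2
              exact h₀ ⟨connectedComponentIn_subset _ _ hmem, lt_of_le_of_lt hl hlt, lt_of_lt_of_le hlt' hr⟩
            · exact Or.inr heq'
          · exact Or.inl heq.symm
        have hgy₀ : g n y₀ = D'.boundary y₀ := by
          simp only [hg, dif_pos hn]
          rcases hy₀' with rfl | rfl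
          · rw [sub_self, zero_div, (modelPath_zero_one hη0 hη S n).1, ← (bPar_zero_one).1,
              (d n hn).hG1 0 ⟨le_rfl, zero_le_one⟩, mul_zero, add_zero]
          · rw [div_self (by linarith : θ₂ - θ₁ ≠ 0), (modelPath_zero_one hη0 hη S n).2, ← (bPar_zero_one).2,
              (d n hn).hG1 1 ⟨zero_le_one, le_rfl⟩, mul_one, add_sub_cancel]
        have hgt : ∀ᶠ y in 𝓝 y₀, dist (g n y) (D'.boundary y₀) < ε := by
          have := Metric.tendsto_nhds.1 ((hgc n).tendsto y₀) ε hε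
          rwa [hgy₀] at this
        filter_upwards [hgt] with y hy h hfind
        rwa [hΓg y h, hfind]
      · -- `y₀` is away from the closed component: eventually no `y` has first hit `n`
        have hopen : (Icc θ₁ θ₂)ᶜ ∈ 𝓝 y₀ := isClosed_Icc.isOpen_compl.mem_nhds hy₀
        filter_upwards [hopen] with y hy h hfind
        exact absurd (Ioo_subset_Icc_self (hmemn y h hfind)) hy
    have hall := (hBfin.eventually_all.2 hlarge).and hw
    filter_upwards [hall] with y ⟨hyB, hyw⟩
    by_cases h : y ∈ F ∧ y ∈ Ioo (D'.mark 0) (D'.mark 0 + 1)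
    swap
    · rw [loopΓ_of_not xs d hex η S h]; linarith
    by_cases hB' : Nat.find (hex y h) ∈ B
    · exact hyB _ hB' h rfl
    · obtain ⟨hgood, hcc, hmin⟩ := firstHit_spec xs hex h
      obtain ⟨hcl, -, -, -⟩ := loopΓ_mem xs d hex hF hsub h0 h1 hη0 hη S h
      obtain ⟨hccn, -, -, -, -, -, -, -⟩ := free_component hF h0 h1 hgood.1 hgood.2
      have hyθ : y ∈ Icc (sInf (connectedComponentIn F (xs (Nat.find (hex y h)))))
          (sSup (connectedComponentIn F (xs (Nat.find (hex y h))))) := by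
        have : y ∈ connectedComponentIn F (xs (Nat.find (hex y h))) := by
          rw [hcc]; exact mem_connectedComponentIn h.1
        rw [hccn] at this
        exact Ioo_subset_Icc_self this
      have hd := hB _ ⟨hgood, hmin⟩ hB' _ hcl y hyθ
      calc dist (loopΓ xs d hex η S y) (D'.boundary y₀)
          ≤ dist (loopΓ xs d hex η S y) (D'.boundary y) + dist (D'.boundary y) (D'.boundary y₀) := dist_triangle
              _ _ _
        _ < ε / 2 + ε / 2 := add_lt_add hd hyw
        _ = ε := by ring

end Loop

/-- **Registered helper stub `stub_radoLoop`** (towards `stub_radoSqueezeFamily`, line `birth`): the model path of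
an index is continuous and injective on `[0, 1]`, in closed form. [folklore] -/
theorem stub_radoLoop :
    ∀ (η : ℝ), 0 < η → η ≤ 1 / 4 → ∀ (S : Finset ℕ) (n : ℕ),
      Continuous (Summit.CriticalPhenomena.SAWScalingLimit.Theorems.RestrictionOfLimit.Birth.modelPath η S n) ∧
          Set.InjOn (Summit.CriticalPhenomena.SAWScalingLimit.Theorems.RestrictionOfLimit.Birth.modelPath η S n)
          (Set.Icc 0 1) :=
  fun _ hη0 hη S n ↦ ⟨continuous_modelPath _ S n, modelPath_injOn hη0 hη S n⟩

end Summit.CriticalPhenomena.SAWScalingLimit.Theorems.RestrictionOfLimit.Birth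

end
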